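import Summits.ResolutionOfSingularities.ResolutionOfSingularities.Theses.WildQuotients
import Summits.ResolutionOfSingularities.ResolutionOfSingularities.Theorems.WildQuotientsGaloisReduction
import Literature.AlgebraicGeometry.Resolution.AlterationsResolution
import Literature.AlgebraicGeometry.Resolution.ResolutionOfCurves
import HarnessLib

/-!
# WildQuotients / `GaloisQuotientAlteration` — upper bound (item stmt-ResolutionOfSingularities-16323)

Calibration of the support item `GaloisQuotientAlteration` of route
`ResolutionOfSingularities/WildQuotients` FROM ABOVE, unconditionally. The item (de Jong 1997,
Thm. 5.13 / Cor. 5.15 read through the scheme quotient `X'/G`) asks, for every integral separated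
`X` of finite type over a field `k` of characteristic `p`, for a regular integral `X'` with a finite
group `G` acting, a finite surjective generically étale `G`-invariant `q : X' → X₁` with fibres the
`G`-orbits, and `φ : X₁ → X` proper, surjective, finite and universally injective over a dense open.

* `exists_galoisQuotientAlteration_of_isPurelyInseparableAlteration` — the TRIVIAL-GROUP datum: a
  purely inseparable alteration `φ : Y → X` with REGULAR source already is such a datum, with
  `X' = X₁ = Y`, `q = 𝟙`, `G = 1` (the identity is finite, surjective, étale, invariant, and its
  fibres are the orbits of the trivial group). Hence the conclusion of the item at `X` follows from
  a resolution of `X` (`…_of_hasResolution`: a resolution is a purely inseparable regular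
  alteration, Temkin 2013 §1 (i) ⊂ (iii), in tree `IsResolution.isPurelyInseparableAlteration`), so
  it holds UNCONDITIONALLY for regular `X` (`…_of_isRegular`) and for curves (`…_of_dim_le_one`, the
  normalisation, in tree `hasResolution_of_dim_le_one`), and for `dim X ≤ 3` modulo the named fact
  `CossartPiltant2019` (`…_of_cossartPiltant2019`).
* `galoisQuotientAlteration_of_pialt : Pialt → GaloisQuotientAlteration` — the item is implied by
  the route's TARGET (Abramovich–Oort); with the compositional half of the de Jong reduction already
  in tree (`galoisReduction_of_galoisQuotientAlteration : GaloisQuotientAlteration →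
  WildQuotientResolution → Pialt`) this gives `galoisQuotientAlteration_iff_pialt`: MODULO THE CRUX
  `WildQuotientResolution` THE SUPPORT ITEM IS EQUIVALENT TO THE TARGET.
* `galoisQuotientAlteration_of_resolutionOfSingularities : ResolutionOfSingularities →
  GaloisQuotientAlteration` — so a refutation of the item as typed refutes the summit; together with
  the lower bound `exists_isAlteration_isRegular_of_galoisQuotientAlteration`
  (`…GaloisQuotientAlterationLowerBound`: the item gives de Jong 1996 regular alterations in
  characteristic `p`) the item is bracketed `ResolutionInChar p ⇒ item_p ⇒ DeJong1996_p`.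

Nothing here uses de Jong's theorem; the item itself stays conditional on the named fact
`Literature.AlgebraicGeometry.Resolution.DeJong1997_galoisAlterationQuasiProjective`
(`galoisQuotientAlteration_of_deJong1997`, `…Theorems.WildQuotientsGaloisQuotientAlteration`).
-/

noncomputable section

set_option linter.dupNamespace false -- mandated namespace of this single-conjunct summit

namespace Summit.ResolutionOfSingularities.ResolutionOfSingularities.Theorems

open CategoryTheory AlgebraicGeometry TopologicalSpace
open Literature.AlgebraicGeometry.Resolution

universe u

/-! ## The trivial-group datum -/

/-- **A purely inseparable alteration with regular source is a Galois quotient alteration datum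
with trivial group**: given `φ : Y → X` proper, dominant, finite and universally injective over a
non-empty open, with `Y` integral and regular and `X` integral separated of finite type over `k`,
the tuple `(X', X₁, q, φ, G, ρ) = (Y, Y, 𝟙, φ, 1, 1)` satisfies every clause of
`GaloisQuotientAlteration` at `(k, X, f)`: `Y → Spec k` is separated, locally of finite type and
quasi-compact (composite with the proper `φ`), the identity is finite, surjective, étale over
`⊤`, invariant, with singleton fibres = orbits of the trivial group, and `φ` is surjective
(proper and dominant). [folklore; de Jong 1997, 5.3 with `G = G' = 1`] -/
theorem exists_galoisQuotientAlteration_of_isPurelyInseparableAlteration {k : Type u} [Field k]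
    {X : Scheme.{u}} [IsIntegral X] (f : X ⟶ Spec (.of k)) [IsSeparated f] [LocallyOfFiniteType f]
    [QuasiCompact f] {Y : Scheme.{u}} {φ : Y ⟶ X} (hφ : IsPurelyInseparableAlteration φ)
    (hreg : Scheme.IsRegular Y) :
    ∃ (X' X₁ : Scheme.{u}) (q : X' ⟶ X₁) (φ : X₁ ⟶ X) (G : Type u) (_ : Group G) (_ : Finite G)
      (ρ : G →* Aut X'), IsSeparated (φ ≫ f) ∧ LocallyOfFiniteType (φ ≫ f) ∧
      QuasiCompact (φ ≫ f) ∧ IsIntegral X₁ ∧ IsIntegral X' ∧ Scheme.IsRegular X' ∧ IsFinite q ∧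
      Function.Surjective q.base ∧ (∃ U : X₁.Opens, Dense (U : Set X₁) ∧ Etale (q ∣_ U)) ∧
      (∀ g : G, (ρ g).hom ≫ q = q) ∧
      (∀ x y : X', q.base x = q.base y → ∃ g : G, (ρ g).hom.base x = y) ∧ IsProper φ ∧
      Function.Surjective φ.base ∧ ∃ V : X.Opens, Dense (V : Set X) ∧ IsFinite (φ ∣_ V) ∧
      UniversallyInjective (φ ∣_ V) := by
  haveI : IsIntegral Y := hφ.isIntegral
  haveI : IsProper φ := hφ.isProper
  have hsurj : Surjective φ := hφ.surjective
  have h1 : ((1 : PUnit.{u + 1} →* Aut Y) PUnit.unit).hom = 𝟙 Y := rfl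
  refine ⟨Y, Y, 𝟙 Y, φ, PUnit, inferInstance, inferInstance, 1, inferInstance, inferInstance,
    inferInstance, inferInstance, inferInstance, hreg, inferInstance, fun y => ⟨y, rfl⟩,
    ⟨⊤, by simp, inferInstance⟩, fun _ => by rw [h1, Category.id_comp], ?_, inferInstance,
    hsurj.1, hφ.exists_dense⟩
  intro x y hxy
  exact ⟨1, by rw [h1]; exact hxy⟩

/-- **The conclusion of `GaloisQuotientAlteration` at `X` from a resolution of `X`**: a resolution
`π : X̃ → X` of the integral `X` is a purely inseparable alteration with regular source (Temkin
2013, §1 (i) ⊂ (iii); `IsResolution.isPurelyInseparableAlteration`), hence a trivial-group datum.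
[cite: Temkin2013, §1 p. 3 (i), (iii)] -/
theorem exists_galoisQuotientAlteration_of_hasResolution {k : Type u} [Field k]
    {X : Scheme.{u}} [IsIntegral X] (f : X ⟶ Spec (.of k)) [IsSeparated f] [LocallyOfFiniteType f]
    [QuasiCompact f] (h : Scheme.HasResolution X) :
    ∃ (X' X₁ : Scheme.{u}) (q : X' ⟶ X₁) (φ : X₁ ⟶ X) (G : Type u) (_ : Group G) (_ : Finite G)
      (ρ : G →* Aut X'), IsSeparated (φ ≫ f) ∧ LocallyOfFiniteType (φ ≫ f) ∧
      QuasiCompact (φ ≫ f) ∧ IsIntegral X₁ ∧ IsIntegral X' ∧ Scheme.IsRegular X' ∧ IsFinite q ∧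
      Function.Surjective q.base ∧ (∃ U : X₁.Opens, Dense (U : Set X₁) ∧ Etale (q ∣_ U)) ∧
      (∀ g : G, (ρ g).hom ≫ q = q) ∧
      (∀ x y : X', q.base x = q.base y → ∃ g : G, (ρ g).hom.base x = y) ∧ IsProper φ ∧
      Function.Surjective φ.base ∧ ∃ V : X.Opens, Dense (V : Set X) ∧ IsFinite (φ ∣_ V) ∧
      UniversallyInjective (φ ∣_ V) := by
  obtain ⟨Y, φ, hφ, hreg⟩ := h.exists_isPurelyInseparableAlteration_and_isRegular
  exact exists_galoisQuotientAlteration_of_isPurelyInseparableAlteration f hφ hreg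

/-- **`GaloisQuotientAlteration` at a REGULAR `X`, unconditionally**: `X` is its own resolution.
[folklore] -/
theorem exists_galoisQuotientAlteration_of_isRegular {k : Type u} [Field k]
    {X : Scheme.{u}} [IsIntegral X] (f : X ⟶ Spec (.of k)) [IsSeparated f] [LocallyOfFiniteType f]
    [QuasiCompact f] (hX : Scheme.IsRegular X) :
    ∃ (X' X₁ : Scheme.{u}) (q : X' ⟶ X₁) (φ : X₁ ⟶ X) (G : Type u) (_ : Group G) (_ : Finite G)
      (ρ : G →* Aut X'), IsSeparated (φ ≫ f) ∧ LocallyOfFiniteType (φ ≫ f) ∧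
      QuasiCompact (φ ≫ f) ∧ IsIntegral X₁ ∧ IsIntegral X' ∧ Scheme.IsRegular X' ∧ IsFinite q ∧
      Function.Surjective q.base ∧ (∃ U : X₁.Opens, Dense (U : Set X₁) ∧ Etale (q ∣_ U)) ∧
      (∀ g : G, (ρ g).hom ≫ q = q) ∧
      (∀ x y : X', q.base x = q.base y → ∃ g : G, (ρ g).hom.base x = y) ∧ IsProper φ ∧
      Function.Surjective φ.base ∧ ∃ V : X.Opens, Dense (V : Set X) ∧ IsFinite (φ ∣_ V) ∧
      UniversallyInjective (φ ∣_ V) :=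
  exists_galoisQuotientAlteration_of_hasResolution f hX.hasResolution

/-- **`GaloisQuotientAlteration` for CURVES, unconditionally** (every field, every
characteristic): an integral `X` of finite type over `k` with `dim X ≤ 1` is resolved by its
normalisation (`hasResolution_of_dim_le_one`, in tree), which is the datum with trivial group
(de Jong 1996, 4.3: "the case `dim X = 1` … by taking `X₁` to be the normalization of `X`").
[cite: DeJong1996, 4.3, p. 66] -/
theorem exists_galoisQuotientAlteration_of_dim_le_one {k : Type u} [Field k]
    {X : Scheme.{u}} [IsIntegral X] (f : X ⟶ Spec (.of k)) [IsSeparated f] [LocallyOfFiniteType f]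
    [QuasiCompact f] (hdim : topologicalKrullDim X ≤ 1) :
    ∃ (X' X₁ : Scheme.{u}) (q : X' ⟶ X₁) (φ : X₁ ⟶ X) (G : Type u) (_ : Group G) (_ : Finite G)
      (ρ : G →* Aut X'), IsSeparated (φ ≫ f) ∧ LocallyOfFiniteType (φ ≫ f) ∧
      QuasiCompact (φ ≫ f) ∧ IsIntegral X₁ ∧ IsIntegral X' ∧ Scheme.IsRegular X' ∧ IsFinite q ∧
      Function.Surjective q.base ∧ (∃ U : X₁.Opens, Dense (U : Set X₁) ∧ Etale (q ∣_ U)) ∧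
      (∀ g : G, (ρ g).hom ≫ q = q) ∧
      (∀ x y : X', q.base x = q.base y → ∃ g : G, (ρ g).hom.base x = y) ∧ IsProper φ ∧
      Function.Surjective φ.base ∧ ∃ V : X.Opens, Dense (V : Set X) ∧ IsFinite (φ ∣_ V) ∧
      UniversallyInjective (φ ∣_ V) :=
  exists_galoisQuotientAlteration_of_hasResolution f (hasResolution_of_dim_le_one X f hdim)

/-- **`GaloisQuotientAlteration` in dimension `≤ 3`, modulo Cossart–Piltant** (2019, Thm. 1.1,
the named fact `CossartPiltant2019`: resolution of reduced separated finite-type schemes of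
dimension `≤ 3` over any field). [cite: CossartPiltant2019, Thm. 1.1] -/
theorem exists_galoisQuotientAlteration_of_cossartPiltant2019 (hCP : CossartPiltant2019.{u})
    {k : Type u} [Field k] {X : Scheme.{u}} [IsIntegral X] (f : X ⟶ Spec (.of k)) [IsSeparated f]
    [LocallyOfFiniteType f] [QuasiCompact f] (hdim : topologicalKrullDim X ≤ 3) :
    ∃ (X' X₁ : Scheme.{u}) (q : X' ⟶ X₁) (φ : X₁ ⟶ X) (G : Type u) (_ : Group G) (_ : Finite G)
      (ρ : G →* Aut X'), IsSeparated (φ ≫ f) ∧ LocallyOfFiniteType (φ ≫ f) ∧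
      QuasiCompact (φ ≫ f) ∧ IsIntegral X₁ ∧ IsIntegral X' ∧ Scheme.IsRegular X' ∧ IsFinite q ∧
      Function.Surjective q.base ∧ (∃ U : X₁.Opens, Dense (U : Set X₁) ∧ Etale (q ∣_ U)) ∧
      (∀ g : G, (ρ g).hom ≫ q = q) ∧
      (∀ x y : X', q.base x = q.base y → ∃ g : G, (ρ g).hom.base x = y) ∧ IsProper φ ∧
      Function.Surjective φ.base ∧ ∃ V : X.Opens, Dense (V : Set X) ∧ IsFinite (φ ∣_ V) ∧
      UniversallyInjective (φ ∣_ V) :=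
  exists_galoisQuotientAlteration_of_hasResolution f (hCP k X f ‹_› ‹_› ‹_› inferInstance hdim)

/-! ## The item against the route's target and the summit -/

/-- **The target implies the support**: Abramovich–Oort's purely inseparable regular alteration
(`Pialt`, the route's target) is a `GaloisQuotientAlteration` datum with trivial group, prime by
prime and variety by variety. [folklore; de Jong 1997, 5.3 with `G = G' = 1`] -/
theorem galoisQuotientAlteration_of_pialt (h : Theses.WildQuotients.Pialt) :
    Theses.WildQuotients.GaloisQuotientAlteration := by
  intro p hp k _ _ X f hs hl hq hi
  obtain ⟨Y, g, hgp, hiY, hreg, hsurj, U, hU, hfin, hui⟩ := h p hp k X f hs hl hq hi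
  haveI := hi; haveI := hs; haveI := hl; haveI := hq; haveI := hiY; haveI := hgp
  haveI : Surjective g := ⟨hsurj⟩
  exact exists_galoisQuotientAlteration_of_isPurelyInseparableAlteration f
    ⟨hiY, hgp, inferInstance, U, hU.nonempty, hfin, hui⟩ hreg

/-- **Modulo the crux `WildQuotientResolution`, the support `GaloisQuotientAlteration` is
EQUIVALENT to the target `Pialt`**: `→` is the compositional half of the de Jong reduction
(`galoisReduction_of_galoisQuotientAlteration`, in tree: resolve `X₁ = X'/G` by the crux and
compose with `φ`), `←` is `galoisQuotientAlteration_of_pialt`. [cite: DeJong1997, Cor. 5.15] -/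
theorem galoisQuotientAlteration_iff_pialt (hWQ : Theses.WildQuotients.WildQuotientResolution) :
    Theses.WildQuotients.GaloisQuotientAlteration ↔ Theses.WildQuotients.Pialt :=
  ⟨fun h => galoisReduction_of_galoisQuotientAlteration h hWQ, galoisQuotientAlteration_of_pialt⟩

/-- **The summit implies the support**: under resolution of singularities in every positive
characteristic, every integral `X` as in the item is resolved, and a resolution is a trivial-group
datum. Consequently `¬ GaloisQuotientAlteration → ¬ ResolutionOfSingularities`: the item (de Jong
1997, Cor. 5.15 as typed by the route) cannot be refuted short of refuting the summit.
[cite: Temkin2013, §1 p. 3 (i), (iii)] -/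
theorem galoisQuotientAlteration_of_resolutionOfSingularities (h : _root_.ResolutionOfSingularities) :
    Theses.WildQuotients.GaloisQuotientAlteration := by
  intro p hp k _ _ X f hs hl hq hi
  haveI := hi; haveI := hs; haveI := hl; haveI := hq
  exact exists_galoisQuotientAlteration_of_hasResolution f
    ((_root_.ResolutionOfSingularities_iff.mp h) p hp k X f hs hl hq inferInstance)

/-- **Contrapositive**: a counterexample to `GaloisQuotientAlteration` is a counterexample to
resolution of singularities in positive characteristic. [folklore] -/
theorem not_resolutionOfSingularities_of_not_galoisQuotientAlteration
    (h : ¬ Theses.WildQuotients.GaloisQuotientAlteration) : ¬ _root_.ResolutionOfSingularities :=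
  fun hR => h (galoisQuotientAlteration_of_resolutionOfSingularities hR)

end Summit.ResolutionOfSingularities.ResolutionOfSingularities.Theorems

end
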